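import Summits.CriticalPhenomena.Ising3D.Control2DOpeEpsTail
import Mathlib.Tactic.Linarith
import Mathlib.Tactic.Positivity
import Mathlib.Tactic.FieldSimp
import Mathlib.Tactic.Ring
import Mathlib.Tactic.LinearCombination
import HarnessLib

/-!
# Kind `ope2eps`, sense LOWER: the SHARP binomial bound `|C(α, i)| ≤ C(⌈α⌉, i)` and the resulting smaller tail majorant
(cell `pub-ising3x`, seat controls-1 gen 21; KERNEL PATH for the 2D γ-certificates, kind `ope2eps` — CONTROL-ONLY)

HONEST FRAMING: lottery ticket; floor = tightest certified 3D Ising CFT bounds; no exact-solution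
claim without a proof. CONTROL-ONLY (`d = 2`, axiom set `A2D′`); nothing numerical is asserted here.

`Control2DOpeEpsTail.phi_block0_le_QN_add_tail` bounds the dropped double `z`-series of the scalar block through `|C(α, i)| ≤ C(n+i, i)`
(`0 ≤ α ≤ n`), which is loose by `≈ e^{i²/(2n)}` and forces the box truncation up to `N ≈ 96–112` at Λ = 15 (beyond the literal library).
Here the binomial factor is bounded SHARPLY for `n - 1 ≤ α ≤ n` (our `α = Δ/2 + m`, `n = m + 1`): every factor of `α(α-1)⋯(α-i+1)` with `i ≤ n`
is non-negative and `≤` the corresponding factor of `n(n-1)⋯(n-i+1)`, so `|C(α,i)| ≤ C(n,i)`; for `i > n` the remaining factors satisfy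
`|α - j| ≤ j - n + 1`, so `|C(α,i)| ≤ n!(i-n)!/i! ≤ 1` (`abs_ring_choose_le_sharp`). Hence `|q¹(s, α; k)| ≤ B(n,k) := Σ_{i'≤k} (C(n,i') if i' ≤ n, else 1)`
(`abs_qFactor₁_le_bndB`), the pair-monomial bound with `B` (`abs_taylorFunctional2D_half_pairPow_le_sharp`), the geometric tail of
`t_m = 2^{-m} B(m+1, Λ)` with ratio `≤ (N+2)/(2(N+2-Λ))` for `m ≥ N ≥ Λ - 1` (`bndB_succ_le`), and **`phi_block0_le_QN_add_tail_sharp`**: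
`φ[F_-[g_{Δ,0}]] ≤ φ[F_-[Q_N(Δ,0)]] + (1/2)^{2s}(1/2)^Δ · 2W · σ^B_N (2 S^B_N + σ^B_N)` (`0 ≤ Δ ≤ 2`, `2Λ - 2 < N`),
`S^B_N = headMajorB Λ N`, `σ^B_N = tailMajorB Λ N`. Design numerics (KP8/design/epscalc_sharp.py): Λ 15 — N 72 ⇒ tail/|signal| 0.08, N 80 ⇒ 1.7e-3;
Λ 11 — N 56 ⇒ 0.28, N 64 ⇒ 4.8e-3 (the un-sharp majorant needs N ≥ 96 / 80). PROVED; no facts, standard axioms only. [cite: RattazziEtAl2008, §5]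
-/

namespace Summit.CriticalPhenomena.Ising3D.Control2D

open Finset Set
open Literature.MathematicalPhysics.QuantumFieldTheory.ConformalBootstrap3D

/-! ### The sharp binomial bound -/

/-- For `n - 1 ≤ α ≤ n` and `i ≤ n`: `|α(α-1)⋯(α-i+1)| ≤ C(n,i) · i!`. [folklore] -/
theorem abs_descPochhammer_eval_le_choose {α : ℝ} {n : ℕ} (h1 : (n : ℝ) - 1 ≤ α) (h2 : α ≤ n) :
    ∀ i : ℕ, i ≤ n → |(descPochhammer ℝ i).eval α| ≤ ((n.choose i : ℕ) : ℝ) * (i.factorial : ℝ)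
  | 0, _ => by simp
  | i + 1, hi => by
      rw [descPochhammer_succ_eval, abs_mul]
      have ih := abs_descPochhammer_eval_le_choose h1 h2 i (by omega)
      have hin : (i : ℝ) ≤ (n : ℝ) - 1 := by
        have : i + 1 ≤ n := hi
        have : ((i : ℕ) : ℝ) + 1 ≤ (n : ℝ) := by exact_mod_cast this
        linarith
      have hfac : |α - (i : ℝ)| ≤ (n : ℝ) - i := by
        rw [abs_le]; constructor <;> linarith
      have hnn : 0 ≤ (n : ℝ) - i := by linarith
      have hN := Nat.choose_succ_right_eq n i
      have hsub : ((n - i : ℕ) : ℝ) = (n : ℝ) - i := by rw [Nat.cast_sub (by omega)]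
      have hR : (((n.choose (i + 1)) : ℕ) : ℝ) * ((i : ℝ) + 1) = ((n.choose i : ℕ) : ℝ) * ((n : ℝ) - i) := by
        rw [← hsub]; exact_mod_cast hN
      calc |(descPochhammer ℝ i).eval α| * |α - (i : ℝ)|
          ≤ ((n.choose i : ℕ) : ℝ) * (i.factorial : ℝ) * ((n : ℝ) - i) := mul_le_mul ih hfac (abs_nonneg _) (by positivity)
        _ = ((n.choose (i + 1) : ℕ) : ℝ) * ((i + 1).factorial : ℝ) := by
            rw [Nat.factorial_succ]; push_cast; linear_combination (i.factorial : ℝ) * hR.symm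

/-- For `n - 1 ≤ α ≤ n` and `n ≤ i`: `|α(α-1)⋯(α-i+1)| ≤ n! · (i-n)!`. [folklore] -/
theorem abs_descPochhammer_eval_le_factorial {α : ℝ} {n : ℕ} (h1 : (n : ℝ) - 1 ≤ α) (h2 : α ≤ n) :
    ∀ i : ℕ, n ≤ i → |(descPochhammer ℝ i).eval α| ≤ (n.factorial : ℝ) * ((i - n).factorial : ℝ)
  | i, hi => by
      induction i, hi using Nat.le_induction with
      | base =>
          have h := abs_descPochhammer_eval_le_choose h1 h2 n le_rfl
          simpa using h
      | succ i hni ih =>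
          rw [descPochhammer_succ_eval, abs_mul]
          have hiR : (n : ℝ) ≤ i := by exact_mod_cast hni
          have hfac : |α - (i : ℝ)| ≤ (i : ℝ) - n + 1 := by
            rw [abs_le]; constructor <;> linarith
          have hsub : i + 1 - n = (i - n) + 1 := by omega
          rw [hsub, Nat.factorial_succ]
          have hcast : (((i - n : ℕ)) : ℝ) = (i : ℝ) - n := by rw [Nat.cast_sub hni]
          calc |(descPochhammer ℝ i).eval α| * |α - (i : ℝ)|
              ≤ ((n.factorial : ℝ) * ((i - n).factorial : ℝ)) * ((i : ℝ) - n + 1) :=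
                mul_le_mul ih hfac (abs_nonneg _) (by positivity)
            _ = (n.factorial : ℝ) * ((((i - n) + 1 : ℕ) * (i - n).factorial : ℕ) : ℝ) := by
                push_cast; rw [hcast]; ring

/-- The sharp bound on one generalised binomial coefficient: `|C(α,i)| ≤ bnd(n,i)`, `bnd = C(n,i)` for `i ≤ n`, `1` otherwise. [folklore] -/
def bndC (n i : ℕ) : ℕ := if i ≤ n then n.choose i else 1

/-- [folklore] -/
theorem abs_ring_choose_le_sharp {α : ℝ} {n : ℕ} (h1 : (n : ℝ) - 1 ≤ α) (h2 : α ≤ n) (i : ℕ) :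
    |Ring.choose α i| ≤ ((bndC n i : ℕ) : ℝ) := by
  have hf : (0 : ℝ) < i.factorial := by positivity
  rw [choose_eq_descPochhammer_div, abs_div, abs_of_pos hf, div_le_iff₀ hf, bndC]
  split_ifs with hi
  · exact abs_descPochhammer_eval_le_choose h1 h2 i hi
  · have hni : n ≤ i := by omega
    refine (abs_descPochhammer_eval_le_factorial h1 h2 i hni).trans ?_
    have hdvd := Nat.factorial_mul_factorial_dvd_factorial hni
    have hle : n.factorial * (i - n).factorial ≤ i.factorial := Nat.le_of_dvd (Nat.factorial_pos _) hdvd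
    have : ((n.factorial * (i - n).factorial : ℕ) : ℝ) ≤ (i.factorial : ℝ) := by exact_mod_cast hle
    push_cast at this ⊢
    linarith

/-- `B(n,k) = Σ_{i'≤k} bnd(n,i')`. [folklore] -/
def bndB (n k : ℕ) : ℕ := ∑ i ∈ range (k + 1), bndC n i

/-- [folklore] -/
theorem bndB_mono {n k Λ : ℕ} (hk : k ≤ Λ) : bndB n k ≤ bndB n Λ :=
  Finset.sum_le_sum_of_subset (by intro i hi; simp only [Finset.mem_range] at hi ⊢; omega)

/-- `|q¹(s, α; k)| ≤ B(n,k)` for `0 ≤ s ≤ 1`, `n - 1 ≤ α ≤ n`. [folklore] -/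
theorem abs_qFactor₁_le_bndB {s : ℝ} (hs0 : 0 ≤ s) (hs1 : s ≤ 1) {α : ℝ} {n : ℕ} (h1 : (n : ℝ) - 1 ≤ α) (h2 : α ≤ n) (k : ℕ) :
    |qFactor₁ s α k| ≤ ((bndB n k : ℕ) : ℝ) := by
  unfold qFactor₁
  refine (Finset.abs_sum_le_sum_abs _ _).trans ?_
  calc ∑ ij ∈ antidiagonal k, |(-1 : ℝ) ^ ij.1 * Ring.choose s ij.1 * Ring.choose α ij.2|
      ≤ ∑ ij ∈ antidiagonal k, ((bndC n ij.2 : ℕ) : ℝ) := by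
        refine Finset.sum_le_sum fun ij _ => ?_
        rw [abs_mul, abs_mul, abs_pow, abs_neg, abs_one, one_pow, one_mul]
        exact (mul_le_mul (abs_ring_choose_le_one hs0 hs1 _) (abs_ring_choose_le_sharp h1 h2 _) (abs_nonneg _)
          zero_le_one).trans_eq (one_mul _)
    _ = ∑ i ∈ range (k + 1), ((bndC n i : ℕ) : ℝ) := by
        rw [← Finset.Nat.sum_antidiagonal_swap]
        simp only [Prod.snd_swap]
        rw [Finset.Nat.sum_antidiagonal_eq_sum_range_succ (fun i _ => ((bndC n i : ℕ) : ℝ)) k]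
    _ = ((bndB n k : ℕ) : ℝ) := by rw [bndB, Nat.cast_sum]

/-- The ratio step of the sharp majorant: `B(n+1, Λ) · (n+1-Λ) ≤ B(n, Λ) · (n+1)` for `Λ ≤ n`. [folklore] -/
theorem bndB_succ_le {n Λ : ℕ} (hΛ : Λ ≤ n) : bndB (n + 1) Λ * (n + 1 - Λ) ≤ bndB n Λ * (n + 1) := by
  unfold bndB
  rw [Finset.sum_mul, Finset.sum_mul]
  refine Finset.sum_le_sum fun i hi => ?_
  have hiΛ : i ≤ Λ := Nat.lt_succ_iff.mp (Finset.mem_range.mp hi)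
  have h1 : i ≤ n + 1 := by omega
  have h2 : i ≤ n := by omega
  simp only [bndC, if_pos h1, if_pos h2]
  have key := Nat.choose_mul_succ_eq n i   -- n.choose i * (n+1) = (n+1).choose i * (n+1-i)
  calc (n + 1).choose i * (n + 1 - Λ) ≤ (n + 1).choose i * (n + 1 - i) := Nat.mul_le_mul_left _ (by omega)
    _ = n.choose i * (n + 1) := key.symm

/-! ### The sharp majorants -/

/-- `S^B_N = Σ_{m<N} 2^{-m} B(m+1, Λ)`. [folklore] -/
noncomputable def headMajorB (Λ N : ℕ) : ℝ := ∑ m ∈ range N, (1 / 2 : ℝ) ^ m * ((bndB (m + 1) Λ : ℕ) : ℝ)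

/-- `σ^B_N = 2^{-N} B(N+1, Λ) · 2(N+2-Λ)/(N+2-2Λ)` (meaningful for `2Λ < N + 2`). [folklore] -/
noncomputable def tailMajorB (Λ N : ℕ) : ℝ :=
  (1 / 2 : ℝ) ^ N * ((bndB (N + 1) Λ : ℕ) : ℝ) * ((2 * ((N : ℝ) + 2 - Λ)) / ((N : ℝ) + 2 - 2 * Λ))

/-- The geometric tail of the sharp majorant: for `2Λ < N + 2` the terms `t_j = 2^{-(N+j)} B(N+j+1, Λ)` satisfy `t_{j+1} ≤ r t_j`,
`r = (N+2)/(2(N+2-Λ)) < 1`, hence `Σ_j t_j ≤ tailMajorB Λ N`. [folklore] -/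
theorem tsum_tail_le_tailMajorB {Λ N : ℕ} (hN : 2 * Λ < N + 2) :
    Summable (fun j : ℕ => (1 / 2 : ℝ) ^ (j + N) * ((bndB (j + N + 1) Λ : ℕ) : ℝ)) ∧
      ∑' j : ℕ, (1 / 2 : ℝ) ^ (j + N) * ((bndB (j + N + 1) Λ : ℕ) : ℝ) ≤ tailMajorB Λ N := by
  set r : ℝ := ((N : ℝ) + 2) / (2 * ((N : ℝ) + 2 - Λ)) with hr
  have hΛN : (2 : ℝ) * Λ < (N : ℝ) + 2 := by exact_mod_cast hN
  have hd : (0 : ℝ) < (N : ℝ) + 2 - Λ := by linarith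
  have hr0 : 0 ≤ r := by rw [hr]; positivity
  have hr1 : r < 1 := by rw [hr, div_lt_one (by positivity)]; linarith
  have ht0 : ∀ j : ℕ, 0 ≤ (1 / 2 : ℝ) ^ (j + N) * ((bndB (j + N + 1) Λ : ℕ) : ℝ) := fun j => by positivity
  have hrat : ∀ j : ℕ, (1 / 2 : ℝ) ^ (j + 1 + N) * ((bndB (j + 1 + N + 1) Λ : ℕ) : ℝ) ≤
      r * ((1 / 2 : ℝ) ^ (j + N) * ((bndB (j + N + 1) Λ : ℕ) : ℝ)) := by
    intro j
    have hstep := bndB_succ_le (n := j + N + 1) (Λ := Λ) (by omega)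
    have hsub : ((j + N + 1 + 1 - Λ : ℕ) : ℝ) = (j : ℝ) + N + 2 - Λ := by
      rw [Nat.cast_sub (by omega)]; push_cast; ring
    have hR : ((bndB (j + N + 1 + 1) Λ : ℕ) : ℝ) * ((j : ℝ) + N + 2 - Λ) ≤ ((bndB (j + N + 1) Λ : ℕ) : ℝ) * ((j : ℝ) + N + 2) := by
      have := (Nat.cast_le (α := ℝ)).mpr hstep
      push_cast at this; rw [hsub] at this
      linarith [this]
    have hidx : j + 1 + N + 1 = j + N + 1 + 1 := by ring
    rw [hidx, show j + 1 + N = (j + N) + 1 by ring, pow_succ]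
    have hdj : (0 : ℝ) < (j : ℝ) + N + 2 - Λ := by have : (0:ℝ) ≤ j := Nat.cast_nonneg j; linarith
    have hB1 : ((bndB (j + N + 1 + 1) Λ : ℕ) : ℝ) ≤ ((bndB (j + N + 1) Λ : ℕ) : ℝ) * (((j : ℝ) + N + 2) / ((j : ℝ) + N + 2 - Λ)) := by
      rw [mul_div_assoc', le_div_iff₀ hdj]; linarith
    have hratio : (1 / 2 : ℝ) * (((j : ℝ) + N + 2) / ((j : ℝ) + N + 2 - Λ)) ≤ r := by
      rw [hr, mul_div_assoc', div_le_div_iff₀ hdj (by positivity)]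
      have hj : (0 : ℝ) ≤ j := Nat.cast_nonneg j
      have hΛ0 : (0 : ℝ) ≤ Λ := Nat.cast_nonneg Λ
      nlinarith [mul_nonneg hj hΛ0]
    have hP : (0 : ℝ) ≤ (1 / 2 : ℝ) ^ (j + N) := by positivity
    have hB0 : (0 : ℝ) ≤ ((bndB (j + N + 1) Λ : ℕ) : ℝ) := Nat.cast_nonneg _
    calc (1 / 2 : ℝ) ^ (j + N) * (1 / 2) * ((bndB (j + N + 1 + 1) Λ : ℕ) : ℝ)
        ≤ (1 / 2 : ℝ) ^ (j + N) * (1 / 2) * (((bndB (j + N + 1) Λ : ℕ) : ℝ) * (((j : ℝ) + N + 2) / ((j : ℝ) + N + 2 - Λ))) :=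
          mul_le_mul_of_nonneg_left hB1 (by positivity)
      _ = ((1 / 2 : ℝ) * (((j : ℝ) + N + 2) / ((j : ℝ) + N + 2 - Λ))) * ((1 / 2 : ℝ) ^ (j + N) * ((bndB (j + N + 1) Λ : ℕ) : ℝ)) := by ring
      _ ≤ r * ((1 / 2 : ℝ) ^ (j + N) * ((bndB (j + N + 1) Λ : ℕ) : ℝ)) := mul_le_mul_of_nonneg_right hratio (mul_nonneg hP hB0)
  obtain ⟨hs, hle⟩ := tsum_le_of_ratio_le hr0 hr1 ht0 hrat
  refine ⟨hs, hle.trans (le_of_eq ?_)⟩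
  simp only [zero_add]
  rw [tailMajorB, hr]
  have hden : (N : ℝ) + 2 - 2 * Λ ≠ 0 := by linarith
  have h1r : 1 - ((N : ℝ) + 2) / (2 * ((N : ℝ) + 2 - Λ)) = ((N : ℝ) + 2 - 2 * Λ) / (2 * ((N : ℝ) + 2 - Λ)) := by
    field_simp; ring
  rw [h1r]
  field_simp

/-- **The table functional on `F_-[pairPow (b+J) b]`** with the SHARP binomial bound (`n_b - 1 ≤ b ≤ n_b`). [folklore] -/
theorem abs_taylorFunctional2D_half_pairPow_le_sharp (S : Finset (ℕ × ℕ)) (w : ℕ × ℕ → ℝ) {s : ℝ} (hs0 : 0 ≤ s)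
    (hs1 : s ≤ 1) {Λ : ℕ} (hΛ : ∀ p ∈ S, p.1 ≤ Λ ∧ p.2 ≤ Λ) {b : ℝ} (hb : 0 ≤ b) {nb : ℕ} (hbn1 : (nb : ℝ) - 1 ≤ b) (hbn : b ≤ nb) (J : ℕ) :
    |taylorFunctional2D (1 / 2) S w (crossF s (-1) (pairPow (b + J) b))| ≤
      (1 / 2 : ℝ) ^ s * (1 / 2 : ℝ) ^ s * (1 / 2 : ℝ) ^ (b + J) * (1 / 2 : ℝ) ^ b *
        (2 * ((bndB (nb + J) Λ : ℕ) : ℝ) * ((bndB nb Λ : ℕ) : ℝ) * absWeight S w) := by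
  rw [taylorFunctional2D_half_crossF_pairPow S w s hb J, abs_mul]
  have hC0 : 0 ≤ (1 / 2 : ℝ) ^ s * (1 / 2 : ℝ) ^ s * (1 / 2 : ℝ) ^ (b + J) * (1 / 2 : ℝ) ^ b := by positivity
  rw [abs_of_nonneg hC0]
  refine mul_le_mul_of_nonneg_left ?_ hC0
  refine (Finset.abs_sum_le_sum_abs _ _).trans ?_
  rw [absWeight, Finset.mul_sum]
  refine Finset.sum_le_sum fun p hp => ?_
  obtain ⟨h1, h2⟩ := hΛ p hp
  set A : ℝ := ((bndB (nb + J) Λ : ℕ) : ℝ) with hA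
  set B : ℝ := ((bndB nb Λ : ℕ) : ℝ) with hB
  have hbJ1 : ((nb + J : ℕ) : ℝ) - 1 ≤ b + J := by push_cast; linarith
  have hbJn : b + J ≤ ((nb + J : ℕ) : ℝ) := by push_cast; linarith
  have hqJ : ∀ k : ℕ, k ≤ Λ → |qFactor₁ s (b + J) k| ≤ A := fun k hk =>
    (abs_qFactor₁_le_bndB hs0 hs1 hbJ1 hbJn k).trans (by rw [hA]; exact_mod_cast bndB_mono hk)
  have hqb : ∀ k : ℕ, k ≤ Λ → |qFactor₁ s b k| ≤ B := fun k hk =>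
    (abs_qFactor₁_le_bndB hs0 hs1 hbn1 hbn k).trans (by rw [hB]; exact_mod_cast bndB_mono hk)
  have hA0 : 0 ≤ A := by rw [hA]; positivity
  have hB0 : 0 ≤ B := by rw [hB]; positivity
  have hbr : |qFactor₁ s (b + J) p.1 * qFactor₁ s b p.2 + qFactor₁ s b p.1 * qFactor₁ s (b + J) p.2| ≤ 2 * A * B := by
    refine (abs_add_le _ _).trans ?_
    rw [abs_mul, abs_mul, two_mul, add_mul]
    refine add_le_add ?_ ?_
    · exact mul_le_mul (hqJ p.1 h1) (hqb p.2 h2) (abs_nonneg _) hA0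
    · exact (mul_le_mul (hqb p.1 h1) (hqJ p.2 h2) (abs_nonneg _) hB0).trans_eq (mul_comm _ _)
  rw [abs_mul, abs_mul, show |(1 - (-1 : ℝ) ^ (p.1 + p.2)) * 2 ^ (p.1 + p.2)| = cfac p from abs_of_nonneg (cfac_nonneg p)]
  calc |w p| * (cfac p * |qFactor₁ s (b + J) p.1 * qFactor₁ s b p.2 + qFactor₁ s b p.1 * qFactor₁ s (b + J) p.2|)
      ≤ |w p| * (cfac p * (2 * A * B)) :=
        mul_le_mul_of_nonneg_left (mul_le_mul_of_nonneg_left hbr (cfac_nonneg p)) (abs_nonneg _)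
    _ = 2 * A * B * (|w p| * cfac p) := by ring

/-! ### The sharp majorant theorem for the scalar block -/

/-- **Δ-uniform SHARP tail majorant for the scalar block under the table functional at `(1/2,1/2)`** (`0 ≤ s ≤ 1`, table indices `≤ Λ`,
`0 ≤ Δ ≤ 2`, `2Λ < N + 2`): with `σ = tailMajorB Λ N` and `S_N = headMajorB Λ N`,
`φ[F_-[g_{Δ,0}]] ≤ φ[F_-[Q_N(Δ,0)]] + (1/2)^{2s} (1/2)^Δ · 2W · σ (2 S_N + σ)`. PROVED (termwise action of `φ`, `a_m(Δ/2) ≤ 1`,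
the sharp pair-monomial bound with `n_b = m'+1`, the product structure of the double series). [cite: RattazziEtAl2008, §5.5] -/
theorem phi_block0_le_QN_add_tail_sharp (S : Finset (ℕ × ℕ)) (w : ℕ × ℕ → ℝ) {s : ℝ} (hs0 : 0 ≤ s) (hs1 : s ≤ 1)
    {Λ : ℕ} (hΛ : ∀ p ∈ S, p.1 ≤ Λ ∧ p.2 ≤ Λ) {Δ : ℝ} (hΔ0 : 0 ≤ Δ) (hΔ2 : Δ ≤ 2) {N : ℕ} (hN : 2 * Λ < N + 2) :
    taylorFunctional2D (1 / 2) S w (crossF s (-1) (globalBlock Δ 0)) ≤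
      taylorFunctional2D (1 / 2) S w (crossF s (-1) (QN N 0 Δ)) +
        (1 / 2 : ℝ) ^ s * (1 / 2 : ℝ) ^ s * (1 / 2 : ℝ) ^ Δ * (2 * absWeight S w) *
          (tailMajorB Λ N * (2 * headMajorB Λ N + tailMajorB Λ N)) := by
  have hφ := isTaylorFunctional_taylorFunctional2D (1 / 2) S w
  have hx0 : (0 : ℝ) < 1 / 2 := by norm_num
  have hx1 : (1 / 2 : ℝ) < 1 := by norm_num
  have hΔℓ : ((0 : ℕ) : ℝ) ≤ Δ := by simpa using hΔ0
  have hρ0 : (0 : ℝ) < 1 / 2 * (1 - 1 / 2) / 2 := by norm_num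
  have hρ : (1 / 2 : ℝ) * (1 - 1 / 2) / 2 < 1 / 2 * (1 - 1 / 2) := by norm_num
  have hs := hφ.hasSum_mul_of_hasSummableGerms hρ0 (hasSummableGerms_pairPow hΔℓ s hx0 hx1 hρ0 hρ)
    (crossF s (-1) (globalBlock Δ 0)) (fun h' k hh hk =>
      hasSum_crossF_globalBlock hΔℓ (mem_Ioo_of_abs_lt (hh.trans hρ)) (mem_Ioo_of_abs_lt (hk.trans hρ)))
  have hh : (Δ + ((0 : ℕ) : ℝ)) / 2 = Δ / 2 := by simp
  have hh' : (Δ - ((0 : ℕ) : ℝ)) / 2 = Δ / 2 := by simp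
  simp only [hh, hh'] at hs
  -- the family, the majorant family
  set φ' := taylorFunctional2D (1 / 2) S w with hφ'
  set F : ℕ × ℕ → ℝ := fun mm => chiralCoeff (Δ / 2) mm.1 * chiralCoeff (Δ / 2) mm.2 *
    φ' (crossF s (-1) (pairPow (Δ / 2 + (mm.1 : ℝ)) (Δ / 2 + (mm.2 : ℝ)))) with hF
  have hsF : HasSum F (φ' (crossF s (-1) (globalBlock Δ 0))) := hs
  set C0 : ℝ := (1 / 2 : ℝ) ^ s * (1 / 2 : ℝ) ^ s with hC0
  set K : ℝ := C0 * (1 / 2 : ℝ) ^ Δ * (2 * absWeight S w) with hK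
  set t : ℕ → ℝ := fun m => (1 / 2 : ℝ) ^ m * ((bndB (m + 1) Λ : ℕ) : ℝ) with ht
  have hC0nn : 0 ≤ C0 := by rw [hC0]; positivity
  have hDpos : 0 < (1 / 2 : ℝ) ^ Δ := Real.rpow_pos_of_pos (by norm_num) _
  have hKnn : 0 ≤ K := by rw [hK]; have := absWeight_nonneg S w; positivity
  have ht0 : ∀ m, 0 ≤ t m := fun m => by rw [ht]; positivity
  have hh0 : 0 ≤ Δ / 2 := by linarith
  have hh2 : Δ / 2 ≤ 2 := by linarith
  -- (1) termwise bound `F (m,m') ≤ K t_m t_{m'}`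
  have hbound : ∀ mm : ℕ × ℕ, F mm ≤ K * (t mm.1 * t mm.2) := by
    intro mm
    obtain ⟨m, m'⟩ := mm
    have ha : 0 ≤ chiralCoeff (Δ / 2) m * chiralCoeff (Δ / 2) m' :=
      mul_nonneg (chiralCoeff_nonneg hh0 _) (chiralCoeff_nonneg hh0 _)
    have ha1 : chiralCoeff (Δ / 2) m * chiralCoeff (Δ / 2) m' ≤ 1 := by
      calc chiralCoeff (Δ / 2) m * chiralCoeff (Δ / 2) m' ≤ 1 * 1 :=
            mul_le_mul (chiralCoeff_le_one hh0 hh2 _) (chiralCoeff_le_one hh0 hh2 _) (chiralCoeff_nonneg hh0 _) zero_le_one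
        _ = 1 := one_mul _
    -- the pair monomial in the form `pairPow (b + J) b`, `b = Δ/2 + min`, `J = |m - m'|`, sharp bound with `n_b = min + 1`
    have hval : |φ' (crossF s (-1) (pairPow (Δ / 2 + (m : ℝ)) (Δ / 2 + (m' : ℝ))))| ≤ K / 2 * (t m * t m') * 2 := by
      rcases le_total m' m with hle | hle
      · obtain ⟨J, rfl⟩ := Nat.exists_eq_add_of_le hle
        have hb : 0 ≤ Δ / 2 + (m' : ℝ) := by positivity
        have hbn1 : ((m' + 1 : ℕ) : ℝ) - 1 ≤ Δ / 2 + (m' : ℝ) := by push_cast; linarith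
        have hbn : Δ / 2 + (m' : ℝ) ≤ ((m' + 1 : ℕ) : ℝ) := by push_cast; linarith
        have hv := abs_taylorFunctional2D_half_pairPow_le_sharp S w hs0 hs1 hΛ hb hbn1 hbn J
        have e1 : Δ / 2 + (m' : ℝ) + (J : ℝ) = Δ / 2 + ((m' + J : ℕ) : ℝ) := by push_cast; ring
        rw [e1] at hv
        refine hv.trans (le_of_eq ?_)
        have e2 : (1 / 2 : ℝ) ^ (Δ / 2 + ((m' + J : ℕ) : ℝ)) * (1 / 2 : ℝ) ^ (Δ / 2 + (m' : ℝ)) =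
            (1 / 2 : ℝ) ^ Δ * ((1 / 2 : ℝ) ^ (m' + J) * (1 / 2 : ℝ) ^ m') := by
          rw [Real.rpow_add_natCast (by norm_num), Real.rpow_add_natCast (by norm_num), ← Real.rpow_natCast,
            ← Real.rpow_natCast]
          have : (1 / 2 : ℝ) ^ Δ = (1 / 2 : ℝ) ^ (Δ / 2) * (1 / 2 : ℝ) ^ (Δ / 2) := by
            rw [← Real.rpow_add (by norm_num)]; ring_nf
          rw [this]; ring
        rw [hK, hC0, ht]
        simp only
        rw [show m' + 1 + J = m' + J + 1 by ring]
        calc (1 / 2 : ℝ) ^ s * (1 / 2 : ℝ) ^ s * (1 / 2 : ℝ) ^ (Δ / 2 + ((m' + J : ℕ) : ℝ)) * (1 / 2 : ℝ) ^ (Δ / 2 + (m' : ℝ)) *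
              (2 * ((bndB (m' + J + 1) Λ : ℕ) : ℝ) * ((bndB (m' + 1) Λ : ℕ) : ℝ) * absWeight S w)
            = (1 / 2 : ℝ) ^ s * (1 / 2 : ℝ) ^ s * ((1 / 2 : ℝ) ^ (Δ / 2 + ((m' + J : ℕ) : ℝ)) * (1 / 2 : ℝ) ^ (Δ / 2 + (m' : ℝ))) *
              (2 * ((bndB (m' + J + 1) Λ : ℕ) : ℝ) * ((bndB (m' + 1) Λ : ℕ) : ℝ) * absWeight S w) := by ring
          _ = _ := by rw [e2]; ring
      · obtain ⟨J, rfl⟩ := Nat.exists_eq_add_of_le hle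
        have hb : 0 ≤ Δ / 2 + (m : ℝ) := by positivity
        have hbn1 : ((m + 1 : ℕ) : ℝ) - 1 ≤ Δ / 2 + (m : ℝ) := by push_cast; linarith
        have hbn : Δ / 2 + (m : ℝ) ≤ ((m + 1 : ℕ) : ℝ) := by push_cast; linarith
        have hv := abs_taylorFunctional2D_half_pairPow_le_sharp S w hs0 hs1 hΛ hb hbn1 hbn J
        have e1 : Δ / 2 + (m : ℝ) + (J : ℝ) = Δ / 2 + ((m + J : ℕ) : ℝ) := by push_cast; ring
        rw [e1] at hv
        rw [show pairPow (Δ / 2 + (m : ℝ)) (Δ / 2 + ((m + J : ℕ) : ℝ)) = pairPow (Δ / 2 + ((m + J : ℕ) : ℝ)) (Δ / 2 + (m : ℝ)) from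
          funext fun z => funext fun zb => pairPow_comm _ _ z zb]
        refine hv.trans (le_of_eq ?_)
        have e2 : (1 / 2 : ℝ) ^ (Δ / 2 + ((m + J : ℕ) : ℝ)) * (1 / 2 : ℝ) ^ (Δ / 2 + (m : ℝ)) =
            (1 / 2 : ℝ) ^ Δ * ((1 / 2 : ℝ) ^ (m + J) * (1 / 2 : ℝ) ^ m) := by
          rw [Real.rpow_add_natCast (by norm_num), Real.rpow_add_natCast (by norm_num), ← Real.rpow_natCast,
            ← Real.rpow_natCast]
          have : (1 / 2 : ℝ) ^ Δ = (1 / 2 : ℝ) ^ (Δ / 2) * (1 / 2 : ℝ) ^ (Δ / 2) := by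
            rw [← Real.rpow_add (by norm_num)]; ring_nf
          rw [this]; ring
        rw [hK, hC0, ht]
        simp only
        rw [show m + 1 + J = m + J + 1 by ring]
        calc (1 / 2 : ℝ) ^ s * (1 / 2 : ℝ) ^ s * (1 / 2 : ℝ) ^ (Δ / 2 + ((m + J : ℕ) : ℝ)) * (1 / 2 : ℝ) ^ (Δ / 2 + (m : ℝ)) *
              (2 * ((bndB (m + J + 1) Λ : ℕ) : ℝ) * ((bndB (m + 1) Λ : ℕ) : ℝ) * absWeight S w)
            = (1 / 2 : ℝ) ^ s * (1 / 2 : ℝ) ^ s * ((1 / 2 : ℝ) ^ (Δ / 2 + ((m + J : ℕ) : ℝ)) * (1 / 2 : ℝ) ^ (Δ / 2 + (m : ℝ))) *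
              (2 * ((bndB (m + J + 1) Λ : ℕ) : ℝ) * ((bndB (m + 1) Λ : ℕ) : ℝ) * absWeight S w) := by ring
          _ = _ := by rw [e2]; ring
    have hKt : 0 ≤ K / 2 * (t m * t m') * 2 := by have := ht0 m; have := ht0 m'; positivity
    calc F (m, m') = chiralCoeff (Δ / 2) m * chiralCoeff (Δ / 2) m' *
          φ' (crossF s (-1) (pairPow (Δ / 2 + (m : ℝ)) (Δ / 2 + (m' : ℝ)))) := by simp only [hF]
      _ ≤ chiralCoeff (Δ / 2) m * chiralCoeff (Δ / 2) m' * (K / 2 * (t m * t m') * 2) :=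
          mul_le_mul_of_nonneg_left ((le_abs_self _).trans hval) ha
      _ ≤ 1 * (K / 2 * (t m * t m') * 2) := mul_le_mul_of_nonneg_right ha1 hKt
      _ = K * (t m * t m') := by ring
  -- (2) the majorant family is summable with sum `K S²`, `S = Σ t`
  obtain ⟨hts, htail⟩ := tsum_tail_le_tailMajorB (Λ := Λ) (N := N) hN
  have htN : Summable fun j : ℕ => t (j + N) := by rw [ht]; exact hts
  have htsum : Summable t := (summable_nat_add_iff N).mp htN
  set Ssum : ℝ := ∑' m, t m with hS
  have hSN : Ssum = headMajorB Λ N + ∑' j, t (j + N) := by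
    rw [hS, headMajorB, ← Summable.sum_add_tsum_nat_add N htsum]
  have hTle : ∑' j, t (j + N) ≤ tailMajorB Λ N := by rw [ht]; exact htail
  have hT0 : 0 ≤ ∑' j, t (j + N) := tsum_nonneg fun j => ht0 _
  have hH0 : 0 ≤ headMajorB Λ N := Finset.sum_nonneg fun m _ => ht0 m
  have hG : HasSum (fun mm : ℕ × ℕ => K * (t mm.1 * t mm.2)) (K * (Ssum * Ssum)) := by
    have h1 := htsum.hasSum.mul htsum.hasSum (htsum.mul_of_nonneg htsum ht0 ht0)
    exact h1.mul_left K
  -- (3) kept square = `φ[Q_N]` for `F`, `K S_N²` for the majorant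
  set R : Finset (ℕ × ℕ) := range N ×ˢ range N with hR
  have hQ : ∑ mm ∈ R, F mm = φ' (crossF s (-1) (QN N 0 Δ)) := by
    have hT := TN_eq_phi_QN φ' s N 0 Δ
    simp only [hh, hh'] at hT
    rw [← hT, hR, Finset.sum_product]
  have hRG : ∑ mm ∈ R, K * (t mm.1 * t mm.2) = K * (headMajorB Λ N * headMajorB Λ N) := by
    rw [hR, ← Finset.mul_sum, Finset.sum_product, headMajorB, Finset.sum_mul_sum]
  -- (4) compare the complements
  have hFc : HasSum (fun x : {x // x ∉ R} => F x) (φ' (crossF s (-1) (globalBlock Δ 0)) - ∑ mm ∈ R, F mm) :=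
    (Finset.hasSum_iff_compl R).mp hsF
  have hGc : HasSum (fun x : {x // x ∉ R} => K * (t x.1.1 * t x.1.2))
      (K * (Ssum * Ssum) - ∑ mm ∈ R, K * (t mm.1 * t mm.2)) :=
    (Finset.hasSum_iff_compl R).mp hG
  have hcmp := hasSum_le (fun x : {x // x ∉ R} => hbound x.1) hFc hGc
  rw [hQ, hRG] at hcmp
  -- (5) `S² - S_N² ≤ σ(2 S_N + σ)`
  have hsq : Ssum * Ssum - headMajorB Λ N * headMajorB Λ N ≤ tailMajorB Λ N * (2 * headMajorB Λ N + tailMajorB Λ N) := by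
    rw [hSN]
    nlinarith [hTle, hT0, hH0]
  have hfin : K * (Ssum * Ssum) - K * (headMajorB Λ N * headMajorB Λ N) ≤
      K * (tailMajorB Λ N * (2 * headMajorB Λ N + tailMajorB Λ N)) := by
    rw [← mul_sub]; exact mul_le_mul_of_nonneg_left hsq hKnn
  have : φ' (crossF s (-1) (globalBlock Δ 0)) - φ' (crossF s (-1) (QN N 0 Δ)) ≤
      K * (tailMajorB Λ N * (2 * headMajorB Λ N + tailMajorB Λ N)) := hcmp.trans hfin
  rw [hK, hC0] at this
  linarith

end Summit.CriticalPhenomena.Ising3D.Control2D
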